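import Summits.Langlands.Langlands.Theorems.IrreducibilityBySelfDualityHeckeEigenvalueFieldStubSandwichOutLemmas
import HarnessLib

/-!
# Reduced families lie in a Siegel domain (stub `stub_sandwich_out`, part 2)

Crux `HeckeEigenvalueField` (stmt-Langlands-13632), line `Sketch`.  The registered stub
`stub_sandwich_out`: for any constants `(c, C, τ)` there is an archimedean Siegel DOMAIN
`𝔖' • 1 = {b bᴴ : b ∈ 𝔖'}`, `𝔖' = (A_G · Ω' · A_{T₀}(t'))_∞` with `Ω' ⊆ B(𝔸_K)` relatively compact
with trivial finite part, containing every matrix `H` over `mixedSpace K = K ⊗ ℝ` whose family of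
places is `(c, C, τ)`-reduced (`SiegelFamily.IsReduced`).  With the sibling `stub_sandwich_in`
(`𝔖 • 1 ⊆ R(c, C, τ)`) this is the sandwich `𝔖 • 1 ⊆ V ⊆ 𝔖' • 1` making the Čech cover of the
Borel–Serre argument locally finite ([Borel1969, §1, §12–§13]: Siegel sets of `GL_n` on the cone
of positive forms).

Proof (descent from the Cholesky coordinates of part 1, `sandOut_cholesky`): write the family of
places as `H_w = u_w diag(λ_{w,·}) u_wᴴ`; with a base place `w₀`, `r = (∏_k λ_{w₀,k}^{1/2})^{1/n}`,
`α_k = λ_{w₀,k}^{1/2} / r` and `μ_{w,k} = (λ_{w,k} / λ_{w₀,k})^{1/2}` one has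
`λ_{w,k}^{1/2} = r μ_{w,k} α_k`, `∏ α_k = 1`, `α_{k+1} ≤ max(τ,1)^{1/2} α_k`,
`μ_{w,k} ∈ [max(C,1)^{-1/2}, max(C,1)^{1/2}]`, so `b = (z(r) · ω · diag(α))_∞` with
`ω = ((u_w diag(μ_w))_w, 1)` (a matrix over `K ⊗ ℝ`, real at the real places,
`sandOut_exists_matrix`) lying in the compact piece `Ω'` of `sandOut_exists_Omega`, and
`b_w b_wᴴ = u_w diag(λ_w) u_wᴴ = H_w` at every place.

## References

* A. Borel, *Introduction aux groupes arithmétiques*, Hermann (1969), §1, §12–§13 [Borel1969].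
-/

noncomputable section

set_option linter.dupNamespace false -- project-wide: `Summit.Langlands.Langlands` is the mandated namespace

open scoped Pointwise NNReal MatrixGroups ComplexOrder Matrix ComplexConjugate
open NumberField NumberField.mixedEmbedding IsDedekindDomain Literature.NumberTheory.Automorphic

namespace Summit.Langlands.Langlands.Theorems.HeckeEigenvalueField.Res

/-! ### 1. Matrices over `K ⊗ ℝ` with prescribed family of places -/

section Places

variable {n : ℕ} {K : Type} [Field K]

/-- The family of places of a matrix over `K ⊗ ℝ` is real at the real places. [folklore] -/
theorem sandOut_conj_placeFamily (H : Matrix (Fin n) (Fin n) (mixedSpace K)) {w : InfinitePlace K}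
    (hw : w.IsReal) (i j : Fin n) :
    conj (SiegelFamily.placeFamily K H w i j) = SiegelFamily.placeFamily K H w i j := by
  rw [SiegelFamily.placeFamily_apply_of_isReal H hw, Matrix.map_apply, Complex.conj_ofReal]

/-- **A family of complex matrices indexed by the infinite places which is real at the real places
is the family of places of a matrix over `K ⊗ ℝ`** (take real parts at the real places).
[folklore] -/
theorem sandOut_exists_matrix (F : InfinitePlace K → Matrix (Fin n) (Fin n) ℂ)
    (hF : ∀ w, w.IsReal → ∀ i j, conj (F w i j) = F w i j) :
    ∃ G : Matrix (Fin n) (Fin n) (mixedSpace K), SiegelFamily.placeFamily K G = F ∧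
      (∀ i j (w : {w : InfinitePlace K // w.IsReal}), (G i j).1 w = (F w.1 i j).re) ∧
      ∀ i j (w : {w : InfinitePlace K // w.IsComplex}), (G i j).2 w = F w.1 i j := by
  refine ⟨Matrix.of fun i j => (fun w => (F w.1 i j).re, fun w => F w.1 i j), ?_,
    fun _ _ _ => rfl, fun _ _ _ => rfl⟩
  funext w
  by_cases hw : w.IsReal
  · rw [SiegelFamily.placeFamily_apply_of_isReal _ hw]
    ext i j
    exact Complex.conj_eq_iff_re.mp (hF w hw i j)
  · rw [SiegelFamily.placeFamily_apply_of_isComplex _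
      (InfinitePlace.not_isReal_iff_isComplex.mp hw)]
    rfl

end Places

/-! ### 2. The stub: reduced matrices lie in a Siegel domain -/

section Stub

open scoped Classical in
/-- **Stub SANDWICH-OUT — the reduced matrices lie in an archimedean Siegel domain**: for any
constants `(c, C, τ)` there are a relatively compact archimedean piece `Ω` of the Borel subgroup
(with trivial finite part) and `t > 0` such that every matrix `H` over `mixedSpace K` with
`(c, C, τ)`-reduced family of places is `b bᴴ` with `b` the archimedean component of an element
of `A_G · Ω · A_{T₀}(t)`.  Recursive Cholesky `H_w = u_w Λ_w u_wᴴ` (`sandOut_cholesky`), then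
split `Λ_{w,k} = (r · μ_{w,k} · α_k)²` with `r = (∏_k Λ_{w₀,k}^{1/2})^{1/n}`,
`α_k = Λ_{w₀,k}^{1/2} / r` (`∏ α_k = 1`, `α_{k+1} / α_k < τ^{1/2}`) and
`μ_{w,k} = (Λ_{w,k} / Λ_{w₀,k})^{1/2} ∈ (C^{-1/2}, C^{1/2})`:
`b = z(r) · (u_w diag(μ_w))_w · diag(α)` with `ω = ((u_w diag(μ_w))_w, 1) ∈ Ω`, the compact piece
of `sandOut_exists_Omega` for the bounds
`N = max(|c|, 1) · max(C, 1)^{1/2}`, `ε = max(C, 1)^{-1/2}`, and `t = max(τ, 1)^{-1/2}`.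
[cite: Borel1969, §1, §12–§13] -/
theorem stub_sandwich_out (n : ℕ) (K : Type) [Field K] [NumberField K] (c C τ : ℝ) :
    ∃ (Ω : Set (GL (Fin n) (AdeleRing (𝓞 K) K))) (t : ℝ), 0 < t ∧
      Ω ⊆ (standardParabolicGL (AdeleRing (𝓞 K) K) (id : Fin n → Fin n) :
        Set (GL (Fin n) (AdeleRing (𝓞 K) K))) ∧
      Ω ⊆ Set.range (GLn.ofInfinite n K) ∧ IsCompact (closure Ω) ∧
      ∀ H : Matrix (Fin n) (Fin n) (mixedSpace K),
        SiegelFamily.IsReduced c C τ n (SiegelFamily.placeFamily K H) →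
          ∃ b ∈ GLn.toMixed n K ''
              (((posRealScalar n K).range : Set (GL (Fin n) (AdeleRing (𝓞 K) K))) * Ω *
                siegelCone n K t),
            (b : Matrix (Fin n) (Fin n) (mixedSpace K)) *
              (b : Matrix (Fin n) (Fin n) (mixedSpace K))ᴴ = H := by
  -- the constants
  set c₁ : ℝ := max |c| 1 with hc₁
  set C₁ : ℝ := max C 1 with hC₁
  set τ₁ : ℝ := max τ 1 with hτ₁
  have hc₁1 : 1 ≤ c₁ := le_max_right _ _
  have hC₁1 : 1 ≤ C₁ := le_max_right _ _
  have hτ₁1 : 1 ≤ τ₁ := le_max_right _ _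
  have hsC : 0 < Real.sqrt C₁ := Real.sqrt_pos.mpr (zero_lt_one.trans_le hC₁1)
  have hsτ : 0 < Real.sqrt τ₁ := Real.sqrt_pos.mpr (zero_lt_one.trans_le hτ₁1)
  obtain ⟨Ω, hΩB, hΩr, hΩc, hΩmem⟩ :=
    sandOut_exists_Omega n K (c₁ * Real.sqrt C₁) (Real.sqrt C₁)⁻¹ (inv_pos.mpr hsC)
  refine ⟨Ω, (Real.sqrt τ₁)⁻¹, inv_pos.mpr hsτ, hΩB, hΩr, hΩc, fun H hH => ?_⟩
  -- (1) Cholesky coordinates of the family of places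
  obtain ⟨u, d, hu1, hu0, huc, hur, hdpos, hdcross, hdratio, hHud⟩ :=
    sandOut_cholesky c C τ (fun w : InfinitePlace K => w.IsReal) n (SiegelFamily.placeFamily K H)
      hH fun w hw i j => sandOut_conj_placeFamily H hw i j
  -- (2) the scalars: base place `w₀`, `r`, `α`, `μ`
  obtain ⟨w₀⟩ : Nonempty (InfinitePlace K) := inferInstance
  set P : ℝ := ∏ k, Real.sqrt (d w₀ k) with hP_def
  have hP : 0 < P := Finset.prod_pos fun k _ => Real.sqrt_pos.mpr (hdpos w₀ k)
  set r : ℝ := P ^ ((n : ℝ)⁻¹) with hr_def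
  have hr : 0 < r := Real.rpow_pos_of_pos hP _
  have hrn : r ^ n = P := by
    rcases Nat.eq_zero_or_pos n with hn | hn
    · subst hn
      simp [hP_def]
    · exact Real.rpow_inv_natCast_pow hP.le hn.ne'
  set α : Fin n → ℝ := fun k => Real.sqrt (d w₀ k) / r with hα_def
  have hαpos : ∀ k, 0 < α k := fun k => div_pos (Real.sqrt_pos.mpr (hdpos w₀ k)) hr
  set μ : InfinitePlace K → Fin n → ℝ := fun w k => Real.sqrt (d w k / d w₀ k) with hμ_def
  have hμpos : ∀ w k, 0 < μ w k := fun w k =>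
    Real.sqrt_pos.mpr (div_pos (hdpos w k) (hdpos w₀ k))
  have hμle : ∀ w k, μ w k ≤ Real.sqrt C₁ := fun w k => by
    refine Real.sqrt_le_sqrt ?_
    rw [div_le_iff₀ (hdpos w₀ k)]
    exact (hdcross w w₀ k).le.trans (mul_le_mul_of_nonneg_right (le_max_left _ _) (hdpos w₀ k).le)
  have hμge : ∀ w k, (Real.sqrt C₁)⁻¹ ≤ μ w k := fun w k => by
    rw [inv_le_comm₀ hsC (hμpos w k), hμ_def]
    dsimp only
    rw [← Real.sqrt_inv, inv_div]
    refine Real.sqrt_le_sqrt ?_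
    rw [div_le_iff₀ (hdpos w k)]
    exact (hdcross w₀ w k).le.trans (mul_le_mul_of_nonneg_right (le_max_left _ _) (hdpos w k).le)
  have hkey : ∀ w k, r * μ w k * α k = Real.sqrt (d w k) := fun w k => by
    have h₁ : Real.sqrt (d w₀ k) ≠ 0 := (Real.sqrt_pos.mpr (hdpos w₀ k)).ne'
    have h₂ : r ≠ 0 := hr.ne'
    rw [hμ_def, hα_def]
    dsimp only
    rw [Real.sqrt_div' _ (hdpos w₀ k).le]
    field_simp
  -- (3) the archimedean element `ω = (g, 1)` with `g_w = u_w diag(μ_w)`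
  set F : InfinitePlace K → Matrix (Fin n) (Fin n) ℂ := fun w =>
    u w * Matrix.diagonal fun k => ((μ w k : ℝ) : ℂ) with hF_def
  have hF : ∀ w i j, F w i j = u w i j * ((μ w j : ℝ) : ℂ) := fun w i j =>
    Matrix.mul_diagonal _ (u w) i j
  have hFr : ∀ w, w.IsReal → ∀ i j, conj (F w i j) = F w i j := fun w hw i j => by
    rw [hF, map_mul, hur w hw, Complex.conj_ofReal]
  obtain ⟨G, hGF, hG₁, hG₂⟩ := sandOut_exists_matrix F hFr
  have hGut : G.BlockTriangular id := fun i j hij => by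
    have hij' : j < i := hij
    refine Prod.ext (funext fun w => ?_) (funext fun w => ?_)
    · rw [hG₁, hF, hu0 _ _ _ hij', zero_mul, Complex.zero_re]
      rfl
    · rw [hG₂, hF, hu0 _ _ _ hij', zero_mul]
      rfl
  have hGd₁ : ∀ k (w : {w : InfinitePlace K // w.IsReal}), (G k k).1 w = μ w.1 k := fun k w => by
    rw [hG₁, hF, hu1, one_mul, Complex.ofReal_re]
  have hGd₂ : ∀ k (w : {w : InfinitePlace K // w.IsComplex}), (G k k).2 w = (μ w.1 k : ℂ) :=
    fun k w => by rw [hG₂, hF, hu1, one_mul]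
  have hGU : IsUnit G := by
    rw [Matrix.isUnit_iff_isUnit_det, Matrix.det_of_upperTriangular hGut, IsUnit.prod_univ_iff]
    intro k
    refine isUnit_iff_exists_inv.mpr ⟨(fun w => (μ w.1 k)⁻¹, fun w => ((μ w.1 k : ℝ) : ℂ)⁻¹),
      Prod.ext (funext fun w => ?_) (funext fun w => ?_)⟩
    · show (G k k).1 w * (μ w.1 k)⁻¹ = 1
      rw [hGd₁]
      exact mul_inv_cancel₀ (hμpos _ _).ne'
    · show (G k k).2 w * ((μ w.1 k : ℝ) : ℂ)⁻¹ = 1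
      rw [hGd₂]
      exact mul_inv_cancel₀ (Complex.ofReal_ne_zero.mpr (hμpos _ _).ne')
  set g : GL (Fin n) (mixedSpace K) := hGU.unit with hg_def
  have hg : (g : Matrix (Fin n) (Fin n) (mixedSpace K)) = G := hGU.unit_spec
  -- the bounds placing `ω` in `Ω`
  have hule : ∀ w i j, ‖u w i j‖ ≤ c₁ := fun w i j => by
    rcases lt_trichotomy i j with hij | rfl | hij
    · exact ((huc w i j hij).le.trans (le_abs_self c)).trans (le_max_left _ _)
    · rw [hu1, norm_one]
      exact hc₁1
    · rw [hu0 w i j hij, norm_zero]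
      exact zero_le_one.trans hc₁1
  have hFle : ∀ w i j, ‖F w i j‖ ≤ c₁ * Real.sqrt C₁ := fun w i j => by
    rw [hF, norm_mul, Complex.norm_real, Real.norm_of_nonneg (hμpos w j).le]
    exact mul_le_mul (hule w i j) (hμle w j) (hμpos w j).le (zero_le_one.trans hc₁1)
  have hω : GLn.ofInfinite n K g ∈ Ω := by
    refine hΩmem g (fun i j => ?_) (by rw [hg]; exact hGut) (fun k w => ?_) fun k w => ?_
    · rw [hg, Prod.norm_def, max_le_iff]
      have h0 : 0 ≤ c₁ * Real.sqrt C₁ := by positivity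
      refine ⟨(pi_norm_le_iff_of_nonneg h0).mpr fun w => ?_,
        (pi_norm_le_iff_of_nonneg h0).mpr fun w => ?_⟩
      · rw [hG₁, Real.norm_eq_abs]
        exact (Complex.abs_re_le_norm _).trans (hFle _ i j)
      · rw [hG₂]
        exact hFle _ i j
    · rw [hg, hGd₁]
      exact hμge _ k
    · rw [hg, hGd₂, Complex.ofReal_re]
      exact hμge _ k
  -- (4) the torus elements `z(r) ∈ A_G` and `diag(α) ∈ A_{T₀}(t)`
  set ρ : ℝ≥0ˣ := Units.mk0 (Real.toNNReal r) (by simpa [Real.toNNReal_eq_zero] using hr)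
    with hρ_def
  have hρ : ((ρ : ℝ≥0) : ℝ) = r := by
    rw [hρ_def, Units.val_mk0, Real.coe_toNNReal _ hr.le]
  set αu : Fin n → ℝ≥0ˣ := fun k => Units.mk0 (Real.toNNReal (α k))
    (by simpa [Real.toNNReal_eq_zero] using hαpos k) with hαu_def
  have hαu : ∀ k, ((αu k : ℝ≥0) : ℝ) = α k := fun k => by
    rw [hαu_def]
    dsimp only
    rw [Units.val_mk0, Real.coe_toNNReal _ (hαpos k).le]
  have hcone : posRealDiagonal n K αu ∈ siegelCone n K (Real.sqrt τ₁)⁻¹ := by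
    refine mem_siegelCone_iff.mpr ⟨αu, ?_, fun i j hij => ?_, rfl⟩
    · simp only [hαu, hα_def]
      rw [Finset.prod_div_distrib, Finset.prod_const, Finset.card_univ, Fintype.card_fin, hrn]
      exact div_self hP.ne'
    · rw [hαu, hαu, hα_def]
      dsimp only
      rw [inv_mul_le_iff₀ hsτ, mul_div_assoc', div_le_div_iff_of_pos_right hr,
        ← Real.sqrt_mul (zero_le_one.trans hτ₁1)]
      refine Real.sqrt_le_sqrt ?_
      exact (hdratio w₀ i j hij.symm).le.trans
        (mul_le_mul_of_nonneg_right (le_max_left _ _) (hdpos w₀ i).le)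
  -- (5) the element `b = (z(r) ω diag(α))_∞` and `b bᴴ = H`
  refine ⟨GLn.toMixed n K (posRealScalar n K ρ * GLn.ofInfinite n K g * posRealDiagonal n K αu),
    ⟨_, Set.mul_mem_mul (Set.mul_mem_mul (MonoidHom.mem_range.mpr ⟨ρ, rfl⟩) hω) hcone, rfl⟩, ?_⟩
  have hb : ∀ w, SiegelFamily.placeFamily K ((GLn.toMixed n K (posRealScalar n K ρ *
      GLn.ofInfinite n K g * posRealDiagonal n K αu) : GL (Fin n) (mixedSpace K)) :
        Matrix (Fin n) (Fin n) (mixedSpace K)) w =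
      u w * Matrix.diagonal fun k => ((Real.sqrt (d w k) : ℝ) : ℂ) := fun w => by
    ext i j
    rw [sandIn_placeFamily_toMixed_mul_apply, GLn.toMixed_ofInfinite, hg, hGF, hF,
      Matrix.mul_diagonal, hρ, hαu, ← hkey w j]
    push_cast
    ring
  have hDD : ∀ w, (Matrix.diagonal fun k => ((Real.sqrt (d w k) : ℝ) : ℂ)) *
      (Matrix.diagonal fun k => ((Real.sqrt (d w k) : ℝ) : ℂ))ᴴ =
        Matrix.diagonal fun k => (d w k : ℂ) := fun w => by
    rw [Matrix.diagonal_conjTranspose, Matrix.diagonal_mul_diagonal]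
    congr 1
    funext k
    rw [Pi.star_apply, Complex.star_def, Complex.conj_ofReal, ← Complex.ofReal_mul,
      Real.mul_self_sqrt (hdpos w k).le]
  apply SiegelFamily.placeFamily_injective n
  funext w
  rw [sandIn_placeFamily_mul, sandIn_placeFamily_conjTranspose, hb, hHud w,
    Matrix.conjTranspose_mul, Matrix.mul_assoc, Matrix.mul_assoc,
    ← Matrix.mul_assoc (Matrix.diagonal _) (Matrix.diagonal _)ᴴ, hDD]

end Stub

end Summit.Langlands.Langlands.Theorems.HeckeEigenvalueField.Res
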